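import Summits.AtomisticToContinuum.Crystallization.Theorems.ThreeConeCertificateExactCertificateTransfer1D
import Summits.AtomisticToContinuum.Crystallization.Theorems.ThreeConeCertificateExactCertificateTransfer1DGenerator
import Summits.AtomisticToContinuum.Crystallization.Theorems.ThreeConeCertificateExactCertificateTransfer1DChainEnergy
import Summits.AtomisticToContinuum.Crystallization.Theorems.ThreeConeCertificateExactCertificateTransfer1DCesaro
import Summits.AtomisticToContinuum.Crystallization.Theorems.ThreeConeCertificateExactCertificateTransfer1DPeriodicPosType
import Literature.MathematicalPhysics.StatisticalMechanics.PeriodicConfigurationSums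

/-!
# Crux `ExactCertificate` (stmt-AtomisticToContinuum-11959), line `closure-makes-nogap-exact`, Transfer1D skeleton:
# ENERGETIC CRYSTALLIZATION OF THE LENNARD-JONES CHAIN — `HasPeriodicGroundStateEnergy lennardJones 1`

Support file (`--supports stmt-AtomisticToContinuum-11959`); nothing here closes the 3-D crux.

Conjunct (i) of the summit sub-problem `Crystallization` with `3 ↦ 1`: the ground-state energy per particle `E(N)/N`
of `N` Lennard-Jones particles on a line converges to the MINIMUM of the energy per particle over all periodic
configurations of `ℝ¹`, attained at the zero-pressure chain `aℤ`.  Obtained by the CERTIFICATE METHOD of route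
ThreeConeCertificate from the d = 1 exact certificate of `ThreeConeCertificateExactCertificateTransfer1D.lean`:

* lower bound for finite `N` (Kepler bound): `e(aℤ) = −F_a(0)/2 ≤ E_F(x)/N ≤ E_V(x)/N` (Bochner with unit weights and
  `F_a ≤ V` on `(0,∞)`);
* lower bound for every periodic competitor `Q` WITHOUT trial states: the periodic Bochner inequality
  `F_a(0)/2 + e_{F_a}(Q) ≥ 0` (`stub_periodicPosType1D`, with `stub_latticeGenerator1D` and `stub_cesaro`) and
  monotonicity `e_{F_a}(Q) ≤ e_V(Q)`;
* upper bound: the equally spaced trial state has energy `Σ_{d<N}(N−d)V(da)` (`stub_chainEnergy`) and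
  `(1/N)Σ_{d<N}(N−d)V(da) → Σ_{m≥1}V(ma) = e(aℤ)` (`stub_cesaro`).

The minimal value and the equidistant minimiser agree with Ventevogel 1978 / Ventevogel–Nijboer 1979 (infinite
chain) and Gardner–Radin 1979 (finite `N`); the tree's other solved d = 1 instance is the sticky potential
(`hasPeriodicGroundStateEnergy_stickyPotential_one`).
-/

noncomputable section

namespace Summit.AtomisticToContinuum.Crystallization.Theorems.ThreeConeCertificateExactCertificate.Transfer1D

open Literature.MathematicalPhysics.StatisticalMechanics MeasureTheory Set
open scoped BigOperators

/-- **The one-dimensional magic function** (ρ = 0 reading of the certificate): at the zero-pressure lattice constant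
`a` the pair function `F_a` is of positive type on `ℝ¹`, lies BELOW `V_LJ` on all of `(0,∞)`, coincides with it on `[a,∞)`,
and has `F_a(0) = −2e_{V_LJ}(aℤ)` — a Cohn–Kumar-type two-point certificate for the Lennard-Jones chain at its own density
(the d = 1 instance of a `MagicFunctionLJ`-type statement; in d = 3 no such radial function is expected, census §3/§5). [folklore] -/
theorem exists_magicFunction_one : ∃ (a : ℝ) (f : ℝ → ℝ) (P : PeriodicConfiguration 1), 0 < a ∧
    (∀ (n : ℕ) (y : Fin n → EuclideanSpace ℝ (Fin 1)) (w : Fin n → ℝ),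
      0 ≤ ∑ i, ∑ j, w i * w j * f (dist (y i) (y j))) ∧
    (∀ r : ℝ, 0 < r → f r ≤ lennardJones r) ∧ (∀ r : ℝ, a ≤ r → f r = lennardJones r) ∧
    P.energyPerParticle lennardJones = ∑' k : ℕ, lennardJones (((k : ℝ) + 1) * a) ∧
    f 0 = -2 * P.energyPerParticle lennardJones := by
  obtain ⟨a, ha, hz⟩ := zeroPressure_exists
  obtain ⟨P, hP⟩ := stub_chain a ha
  obtain ⟨htail, hF0⟩ := stub_tailFzero a ha
  set Fa : ℝ → ℝ := fun x => ∑' k : ℕ, ((k : ℝ) + 1) * (lennardJones (|x + a| + ((k : ℝ) + 1) * a)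
      - 2 * lennardJones (|x| + ((k : ℝ) + 1) * a) + lennardJones (|x - a| + ((k : ℝ) + 1) * a)) with hFa
  have hFa_tail : ∀ x : ℝ, a ≤ x → Fa x = lennardJones x := fun x hx => htail x hx
  have hFa_zero : Fa 0 = -2 * ∑' k : ℕ, lennardJones (((k : ℝ) + 1) * a) := by
    rw [← hF0, hFa]
    simp only [zero_add, zero_sub, abs_neg, abs_zero, abs_of_pos ha]
  have hcore : ∀ r : ℝ, 0 < r → r < a → Fa r ≤ lennardJones r :=
    fun r hr hra => stub_coreOf stub_crossing a ha hz r hr hra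
  have hpos : ∀ (n : ℕ) (y : Fin n → EuclideanSpace ℝ (Fin 1)) (w : Fin n → ℝ),
      0 ≤ ∑ i, ∑ j, w i * w j * Fa (dist (y i) (y j)) :=
    stub_posTypeOfPsi a ha (stub_psiPosTypeOf stub_quadAntitone stub_crossing a ha hz)
  refine ⟨a, Fa, P, ha, hpos, fun r hr => ?_, hFa_tail, hP, by rw [hFa_zero, hP]⟩
  by_cases h : r < a
  · exact hcore r hr h
  · exact (hFa_tail r (not_lt.1 h)).le

/-- **ENERGETIC CRYSTALLIZATION OF THE LENNARD-JONES CHAIN.**  The ground-state energy per particle `E(N)/N` of `N`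
Lennard-Jones particles on a line converges to the MINIMUM of the energy per particle over all periodic configurations
of `ℝ¹`, and the minimum is attained (at the zero-pressure chain `aℤ`): `HasPeriodicGroundStateEnergy lennardJones 1` —
the d = 1 analogue of conjunct (i) of the summit sub-problem `Crystallization` (open in d = 3, Blanc–Lewin 2015 §2.3),
obtained here BY THE CERTIFICATE METHOD of route ThreeConeCertificate: the exact certificate gives `e(aℤ) ≤ E(N)/N`
(Kepler bound) and, through the periodic Bochner inequality (`stub_periodicPosType1D`) and `F_a ≤ V`, `e(aℤ) ≤ e(Q)`
for every periodic competitor `Q` without any trial state; the equally spaced trial state (`stub_chainEnergy`) and a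
Cesàro limit (`stub_cesaro`) give `limsup E(N)/N ≤ e(aℤ)`.  The minimal value and the equidistant minimiser agree with
Ventevogel 1978 / Ventevogel–Nijboer 1979 (infinite chain) and Gardner–Radin 1979 (finite `N`). [folklore] -/
theorem hasPeriodicGroundStateEnergy_lennardJones_one : HasPeriodicGroundStateEnergy lennardJones 1 := by
  obtain ⟨a, ha, hz⟩ := zeroPressure_exists
  obtain ⟨P, hP⟩ := stub_chain a ha
  obtain ⟨htail, hF0⟩ := stub_tailFzero a ha
  set Fa : ℝ → ℝ := fun x => ∑' k : ℕ, ((k : ℝ) + 1) * (lennardJones (|x + a| + ((k : ℝ) + 1) * a)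
      - 2 * lennardJones (|x| + ((k : ℝ) + 1) * a) + lennardJones (|x - a| + ((k : ℝ) + 1) * a)) with hFa
  have hFa_tail : ∀ x : ℝ, a ≤ x → Fa x = lennardJones x := fun x hx => htail x hx
  have hFa_zero : Fa 0 = -2 * ∑' k : ℕ, lennardJones (((k : ℝ) + 1) * a) := by
    rw [← hF0, hFa]
    simp only [zero_add, zero_sub, abs_neg, abs_zero, abs_of_pos ha]
  have hcore : ∀ r : ℝ, 0 < r → r < a → Fa r ≤ lennardJones r :=
    fun r hr hra => stub_coreOf stub_crossing a ha hz r hr hra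
  have hpos : ∀ (n : ℕ) (y : Fin n → EuclideanSpace ℝ (Fin 1)) (w : Fin n → ℝ),
      0 ≤ ∑ i, ∑ j, w i * w j * Fa (dist (y i) (y j)) :=
    stub_posTypeOfPsi a ha (stub_psiPosTypeOf stub_quadAntitone stub_crossing a ha hz)
  -- `F_a ≤ V` on all of `(0,∞)`
  have hle : ∀ r : ℝ, 0 < r → Fa r ≤ lennardJones r := fun r hr => by
    by_cases h : r < a
    · exact hcore r hr h
    · exact (hFa_tail r (not_lt.1 h)).le
  have heP : P.energyPerParticle lennardJones = -(Fa 0 / 2) := by rw [hP, hFa_zero]; ring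
  -- (1) `e(P) ≤ e(Q)` for every periodic `Q`: periodic Bochner + monotonicity
  have hleast : ∀ Q : PeriodicConfiguration 1,
      P.energyPerParticle lennardJones ≤ Q.energyPerParticle lennardJones := by
    intro Q
    have hsV : ∀ y : EuclideanSpace ℝ (Fin 1), y ∈ Q.points →
        Summable (fun z : {z : EuclideanSpace ℝ (Fin 1) // z ∈ Q.points ∧ z ≠ y} =>
          lennardJones (dist y z.1)) :=
      fun y _ => Q.summable_lennardJones_dist (by norm_num) y
    -- `F_a`-sites differ from `V`-sites only at the finitely many points within distance `a`
    have hsF : ∀ y : EuclideanSpace ℝ (Fin 1), y ∈ Q.points →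
        Summable (fun z : {z : EuclideanSpace ℝ (Fin 1) // z ∈ Q.points ∧ z ≠ y} => Fa (dist y z.1)) := by
      intro y hy
      have hfin : (Function.support fun z : {z : EuclideanSpace ℝ (Fin 1) // z ∈ Q.points ∧ z ≠ y} =>
          Fa (dist y z.1) - lennardJones (dist y z.1)).Finite := by
        have h1 := Q.finite_inter_points (Metric.isBounded_closedBall (x := y) (r := a))
        refine ((h1.preimage Subtype.val_injective.injOn)).subset fun z hz => ?_
        refine ⟨Metric.mem_closedBall'.2 ?_, z.2.1⟩
        by_contra hlt
        exact hz (show Fa (dist y z.1) - lennardJones (dist y z.1) = 0 by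
          rw [hFa_tail _ (not_le.1 hlt).le, sub_self])
      have h2 : Summable (fun z : {z : EuclideanSpace ℝ (Fin 1) // z ∈ Q.points ∧ z ≠ y} =>
          Fa (dist y z.1) - lennardJones (dist y z.1)) := summable_of_hasFiniteSupport hfin
      simpa using h2.add (hsV y hy)
    have hB := stub_periodicPosType1D stub_latticeGenerator1D stub_cesaro Q Fa hpos hsF
    have hmono : Q.energyPerParticle Fa ≤ Q.energyPerParticle lennardJones := by
      unfold PeriodicConfiguration.energyPerParticle
      refine mul_le_mul_of_nonneg_left (Finset.sum_le_sum fun y hy => ?_) (by positivity)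
      have hyP := Q.mem_points_of_mem_motif hy
      exact (hsF y hyP).tsum_le_tsum (fun z => hle _ (dist_pos.2 fun h => z.2.2 h.symm)) (hsV y hyP)
    linarith
  -- (2) `E(N)/N → e(P)`: squeeze between the Kepler bound and the equally spaced trial state
  have hlower : ∀ N : ℕ, 0 < N →
      P.energyPerParticle lennardJones ≤ groundStateEnergy lennardJones 1 N / N := by
    intro N hN
    have hNr : (0 : ℝ) < N := by exact_mod_cast hN
    rw [le_div_iff₀ hNr, mul_comm]
    haveI : Nonempty {x : Fin N → EuclideanSpace ℝ (Fin 1) // Function.Injective x} :=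
      let ⟨x, hx⟩ := nonempty_injective_config (d := 1) one_pos N; ⟨⟨x, hx⟩⟩
    refine le_ciInf fun x => ?_
    -- `N e(P) = −N F(0)/2 ≤ E_F(x) ≤ E_V(x)`
    have hFE : -((N : ℝ) * Fa 0 / 2) ≤ interactionEnergy Fa x.1 := by
      have h1 := hpos N x.1 (fun _ => 1)
      simp only [one_mul] at h1
      have h2 : ∑ i, ∑ j, Fa (dist (x.1 i) (x.1 j)) = N * Fa 0 + 2 * interactionEnergy Fa x.1 := by
        rw [two_mul_interactionEnergy]
        have h : ∀ i : Fin N, ∑ j, Fa (dist (x.1 i) (x.1 j)) = Fa 0 + siteEnergy Fa x.1 i := fun i => by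
          rw [siteEnergy, ← Finset.add_sum_erase Finset.univ _ (Finset.mem_univ i), dist_self]
        simp only [h, Finset.sum_add_distrib, Finset.sum_const, Finset.card_univ, Fintype.card_fin,
          nsmul_eq_mul]
      rw [h2] at h1
      linarith
    have hVF : interactionEnergy Fa x.1 ≤ interactionEnergy lennardJones x.1 := by
      unfold interactionEnergy
      refine Finset.sum_le_sum fun i _ => Finset.sum_le_sum fun j hj => hle _ ?_
      exact dist_pos.2 fun heq => (Finset.mem_Ioi.1 hj).ne' (x.2 heq.symm)
    rw [heP]
    linarith
  have hupper : ∀ N : ℕ, 0 < N → groundStateEnergy lennardJones 1 N / N ≤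
      (∑ d ∈ Finset.range N, ((N : ℝ) - d) * lennardJones (d * a)) / N := by
    intro N hN
    have hNr : (0 : ℝ) < N := by exact_mod_cast hN
    obtain ⟨hinj, hE⟩ := stub_chainEnergy a ha N
    rw [← hE]
    exact div_le_div_of_nonneg_right (groundStateEnergy_lennardJones_le hinj) hNr.le
  have htend : Filter.Tendsto (fun N : ℕ => groundStateEnergy lennardJones 1 N / N) Filter.atTop
      (nhds (P.energyPerParticle lennardJones)) := by
    -- the trial-state energies per particle converge to `Σ_{d≥0} V(da) = Σ_{m≥1} V(ma) = e(P)`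
    have hs1 : Summable (fun k : ℕ => lennardJones (((k : ℝ) + 1) * a)) := by
      have hw := summable_mul_lennardJones_of_le
        ha (fun k : ℕ => ((k : ℝ) + 1) * a) (fun k => le_rfl)
      refine Summable.of_norm_bounded hw.norm fun k => ?_
      rw [Real.norm_eq_abs, Real.norm_eq_abs, abs_mul, abs_of_pos (by positivity : (0 : ℝ) < (k : ℝ) + 1)]
      exact le_mul_of_one_le_left (abs_nonneg _) (by linarith [(k.cast_nonneg : (0 : ℝ) ≤ k)])
    have hs0 : Summable (fun d : ℕ => lennardJones ((d : ℝ) * a)) := by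
      refine (summable_nat_add_iff 1).1 (hs1.congr fun k => ?_)
      push_cast
      rfl
    have hc := stub_cesaro _ hs0
    have hsum0 : ∑' d : ℕ, lennardJones ((d : ℝ) * a) = P.energyPerParticle lennardJones := by
      rw [hP, hs0.tsum_eq_zero_add]
      simp only [Nat.cast_zero, zero_mul, lennardJones_zero, zero_add]
      push_cast
      rfl
    rw [hsum0] at hc
    refine tendsto_of_tendsto_of_tendsto_of_le_of_le' tendsto_const_nhds hc ?_ ?_
    · exact Filter.eventually_atTop.2 ⟨1, fun N hN => hlower N hN⟩
    · exact Filter.eventually_atTop.2 ⟨1, fun N hN => hupper N hN⟩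
  exact ⟨P, ⟨⟨P, rfl⟩, by rintro _ ⟨Q, rfl⟩; exact hleast Q⟩, htend⟩

end Summit.AtomisticToContinuum.Crystallization.Theorems.ThreeConeCertificateExactCertificate.Transfer1D

end
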